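import Summits.AtomisticToContinuum.Crystallization.Theorems.SlackRigidity.Negative.WitnessBasics
import Literature.MathematicalPhysics.StatisticalMechanics.LennardJonesClusters
import Mathlib.Analysis.Normed.Group.FunctionSeries
import Mathlib.Analysis.SpecificLimits.Basic
import Mathlib.Data.Nat.Log
import HarnessLib

/-!
# Line `signed-root-silent-field` (crux `SlackRigidity`, item 11960): fields over separated sets

Helper file (A) of stub `stub_localLimitField`: the smeared field `Φ_X(y) = Σ_{q ∈ X} K(|y − q|)`
of a kernel profile `K : ℝ → ℝ` with `|K(r)| ≤ C_K (1+r)⁻⁴` over a `1/3`-SEPARATED point set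
`X ⊆ ℝ³` (possibly infinite).

* `sum_inv_one_add_dist_pow_four_le` — DYADIC SHELL COUNTING: for a finite `1/3`-separated `t`
  all of whose points are at distance `≥ ρ` from `y`, `Σ_{z ∈ t} (1 + |y − z|)⁻⁴ ≤ 8788/(1+ρ)`
  (the shell `2ᵇ ≤ 1 + |y − z| < 2ᵇ⁺¹` holds `≤ (13·2ᵇ)³` points by the packing bound
  `card_le_of_separated_of_dist_le`, each weighing `≤ 2⁻⁴ᵇ`; geometric tail);
* `summable_kernel_of_separated` (anchor), `abs_tsum_kernel_le`, `abs_tsum_sub_sum_kernel_le` —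
  absolute summability of the field, the uniform bound `|Φ_X(y)| ≤ 8788 C_K`, and the UNIFORM TAIL
  BOUND `C_K · 8788/(1+ρ)` for the contribution of the points at distance `≥ ρ`;
* `continuous_tsum_kernel` — continuity of `Φ_X` for continuous `K` (locally uniform convergence,
  `continuousOn_tsum`).

All `[folklore]` (lattice sums of `(1+r)^{-(d+1)}` over Delone sets).  No measure theory here; the
matching comparison and the silence of the local limit are in the sequel file.
-/

noncomputable section

open scoped BigOperators Topology
open Filter Set Metric
open Literature.MathematicalPhysics.StatisticalMechanics
open Summit.AtomisticToContinuum.Crystallization.Theorems.SlackRigidityNegative (E3)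

namespace Summit.AtomisticToContinuum.Crystallization.Theorems.SignedRootLocalLimit

/-- Dyadic bracketing of `1 + x` for `x ≥ 0`: with `n = log₂ ⌊1 + x⌋`, `2ⁿ ≤ 1 + x < 2ⁿ⁺¹`.
[folklore] -/
theorem two_pow_log_le_and_lt {x : ℝ} (hx : 0 ≤ x) :
    (2 : ℝ) ^ Nat.log 2 ⌊1 + x⌋₊ ≤ 1 + x ∧ 1 + x < (2 : ℝ) ^ (Nat.log 2 ⌊1 + x⌋₊ + 1) := by
  have h1 : (1 : ℕ) ≤ ⌊1 + x⌋₊ := Nat.le_floor (by push_cast; linarith)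
  constructor
  · have h2 : 2 ^ Nat.log 2 ⌊1 + x⌋₊ ≤ ⌊1 + x⌋₊ := Nat.pow_log_le_self 2 (by omega)
    calc (2 : ℝ) ^ Nat.log 2 ⌊1 + x⌋₊ = ((2 ^ Nat.log 2 ⌊1 + x⌋₊ : ℕ) : ℝ) := by push_cast; rfl
      _ ≤ (⌊1 + x⌋₊ : ℝ) := by exact_mod_cast h2
      _ ≤ 1 + x := Nat.floor_le (by linarith)
  · have h2 : ⌊1 + x⌋₊ < 2 ^ (Nat.log 2 ⌊1 + x⌋₊ + 1) := Nat.lt_pow_succ_log_self (by norm_num) _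
    have h3 : ⌊1 + x⌋₊ + 1 ≤ 2 ^ (Nat.log 2 ⌊1 + x⌋₊ + 1) := h2
    calc 1 + x < (⌊1 + x⌋₊ : ℝ) + 1 := Nat.lt_floor_add_one _
      _ = ((⌊1 + x⌋₊ + 1 : ℕ) : ℝ) := by push_cast; rfl
      _ ≤ ((2 ^ (Nat.log 2 ⌊1 + x⌋₊ + 1) : ℕ) : ℝ) := by exact_mod_cast h3
      _ = (2 : ℝ) ^ (Nat.log 2 ⌊1 + x⌋₊ + 1) := by push_cast; rfl

/-- A finite sum of `(1/2)^b` over naturals `b ≥ b₀` is at most `2 · (1/2)^{b₀}`. [folklore] -/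
theorem sum_half_pow_le (B : Finset ℕ) {b₀ : ℕ} (hB : ∀ b ∈ B, b₀ ≤ b) :
    ∑ b ∈ B, (1 / 2 : ℝ) ^ b ≤ 2 * (1 / 2 : ℝ) ^ b₀ := by
  have hsub : B ⊆ Finset.Ico b₀ (B.sup id + 1) := fun b hb =>
    Finset.mem_Ico.2 ⟨hB b hb, Nat.lt_succ_of_le (Finset.le_sup (f := id) hb)⟩
  calc ∑ b ∈ B, (1 / 2 : ℝ) ^ b ≤ ∑ b ∈ Finset.Ico b₀ (B.sup id + 1), (1 / 2 : ℝ) ^ b :=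
        Finset.sum_le_sum_of_subset_of_nonneg hsub fun b _ _ => by positivity
    _ = ∑ k ∈ Finset.range (B.sup id + 1 - b₀), (1 / 2 : ℝ) ^ (b₀ + k) :=
        Finset.sum_Ico_eq_sum_range _ _ _
    _ = (1 / 2 : ℝ) ^ b₀ * ∑ k ∈ Finset.range (B.sup id + 1 - b₀), (1 / 2 : ℝ) ^ k := by
        rw [Finset.mul_sum]
        refine Finset.sum_congr rfl fun k _ => ?_
        rw [pow_add]
    _ ≤ (1 / 2 : ℝ) ^ b₀ * 2 :=
        mul_le_mul_of_nonneg_left (sum_geometric_two_le _) (by positivity)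
    _ = 2 * (1 / 2 : ℝ) ^ b₀ := by ring

/-- **Dyadic shell bound.** For a finite `1/3`-separated `t ⊆ ℝ³`, a centre `y` and `ρ ≥ 0`
with all points of `t` at distance `≥ ρ` from `y`, `∑_{z ∈ t} (1 + |y − z|)⁻⁴ ≤ 8788 / (1 + ρ)`:
the dyadic shell `2ᵇ ≤ 1 + |y − z| < 2ᵇ⁺¹` holds at most `(13 · 2ᵇ)³` points (packing bound
`card_le_of_separated_of_dist_le`), each contributing `≤ 2⁻⁴ᵇ`, and the occurring `b` have
`2ᵇ⁺¹ > 1 + ρ`. [folklore] -/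
theorem sum_inv_one_add_dist_pow_four_le (t : Finset E3) (y : E3) {ρ : ℝ} (hρ : 0 ≤ ρ)
    (hsep : ∀ z ∈ t, ∀ w ∈ t, z ≠ w → (1 / 3 : ℝ) ≤ dist z w)
    (hfar : ∀ z ∈ t, ρ ≤ dist y z) :
    ∑ z ∈ t, ((1 + dist y z) ^ 4)⁻¹ ≤ 8788 / (1 + ρ) := by
  classical
  set m : E3 → ℕ := fun z => Nat.log 2 ⌊1 + dist y z⌋₊ with hm
  set B := t.image m with hB
  set G : ℕ → ℝ := fun b => (((2 : ℝ) ^ b) ^ 4)⁻¹ with hG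
  have hmem : ∀ z ∈ t, m z ∈ B := fun z hz => Finset.mem_image_of_mem m hz
  have hlow : ∀ z, (2 : ℝ) ^ (m z) ≤ 1 + dist y z := fun z =>
    (two_pow_log_le_and_lt (dist_nonneg : 0 ≤ dist y z)).1
  have hupp : ∀ z, 1 + dist y z < (2 : ℝ) ^ (m z + 1) := fun z =>
    (two_pow_log_le_and_lt (dist_nonneg : 0 ≤ dist y z)).2
  -- termwise comparison with the dyadic weight
  have step1 : ∑ z ∈ t, ((1 + dist y z) ^ 4)⁻¹ ≤ ∑ z ∈ t, G (m z) := by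
    refine Finset.sum_le_sum fun z _ => ?_
    exact inv_anti₀ (by positivity) (pow_le_pow_left₀ (by positivity) (hlow z) 4)
  -- regroup by shells
  have step2 : ∑ z ∈ t, G (m z) = ∑ b ∈ B, ((t.filter fun z => m z = b).card : ℝ) * G b := by
    rw [← Finset.sum_fiberwise_of_maps_to' hmem]
    refine Finset.sum_congr rfl fun b _ => ?_
    rw [Finset.sum_const, nsmul_eq_mul]
  -- each shell holds at most `(13 · 2ᵇ)³` points
  have step3 : ∀ b ∈ B, ((t.filter fun z => m z = b).card : ℝ) ≤ (13 * (2 : ℝ) ^ b) ^ 3 := by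
    intro b _
    have hR : (0 : ℝ) ≤ (2 : ℝ) ^ (b + 1) := by positivity
    have h := card_le_of_separated_of_dist_le (t.filter fun z => m z = b) y
      (by norm_num : (0 : ℝ) < 1 / 3) hR ?_ ?_
    · rw [finrank_euclideanSpace_fin] at h
      refine h.trans ?_
      have h1 : (1 : ℝ) ≤ (2 : ℝ) ^ b := one_le_pow₀ (by norm_num)
      have h2 : 2 * (2 : ℝ) ^ (b + 1) / (1 / 3) + 1 ≤ 13 * (2 : ℝ) ^ b := by
        rw [pow_succ]
        field_simp
        linarith
      exact pow_le_pow_left₀ (by positivity) h2 3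
    · intro c hc
      obtain ⟨-, hcb⟩ := Finset.mem_filter.1 hc
      rw [dist_comm]
      have := hupp c
      rw [hcb] at this
      linarith
    · intro c hc d hd hcd
      exact hsep c (Finset.mem_filter.1 hc).1 d (Finset.mem_filter.1 hd).1 hcd
  -- per-shell numerics
  have step4 : ∀ b : ℕ, (13 * (2 : ℝ) ^ b) ^ 3 * G b = 2197 * (1 / 2 : ℝ) ^ b := by
    intro b
    simp only [hG]
    have h2 : (2 : ℝ) ^ b ≠ 0 := pow_ne_zero _ two_ne_zero
    rw [one_div_pow]
    field_simp
    ring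
  -- the occurring shells
  set b₀ : ℕ := Nat.log 2 ⌊1 + ρ⌋₊ with hb₀
  have hb₀le : ∀ b ∈ B, b₀ ≤ b := by
    intro b hb
    obtain ⟨z, hz, rfl⟩ := Finset.mem_image.1 hb
    exact Nat.log_mono_right (Nat.floor_le_floor (by linarith [hfar z hz]))
  have hb₀ρ : (1 / 2 : ℝ) ^ b₀ ≤ 2 / (1 + ρ) := by
    have h := (two_pow_log_le_and_lt hρ).2
    rw [pow_succ] at h
    rw [one_div_pow, one_div_le (by positivity) (by positivity), div_div_eq_mul_div]
    rw [div_le_iff₀ (by norm_num : (0:ℝ) < 2)]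
    linarith
  have step5 : ∑ b ∈ B, (1 / 2 : ℝ) ^ b ≤ 4 / (1 + ρ) :=
    calc ∑ b ∈ B, (1 / 2 : ℝ) ^ b ≤ 2 * (1 / 2 : ℝ) ^ b₀ := sum_half_pow_le B hb₀le
      _ ≤ 2 * (2 / (1 + ρ)) := by linarith
      _ = 4 / (1 + ρ) := by ring
  calc ∑ z ∈ t, ((1 + dist y z) ^ 4)⁻¹ ≤ ∑ b ∈ B, ((t.filter fun z => m z = b).card : ℝ) * G b :=
        step1.trans_eq step2
    _ ≤ ∑ b ∈ B, (13 * (2 : ℝ) ^ b) ^ 3 * G b :=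
        Finset.sum_le_sum fun b hb => mul_le_mul_of_nonneg_right (step3 b hb) (by positivity)
    _ = ∑ b ∈ B, 2197 * (1 / 2 : ℝ) ^ b := Finset.sum_congr rfl fun b _ => step4 b
    _ = 2197 * ∑ b ∈ B, (1 / 2 : ℝ) ^ b := by rw [Finset.mul_sum]
    _ ≤ 2197 * (4 / (1 + ρ)) := mul_le_mul_of_nonneg_left step5 (by norm_num)
    _ = 8788 / (1 + ρ) := by ring


/-! ## Fields `Σ_{q ∈ X} K(|y − q|)` over `1/3`-separated sets -/

/-- The decay constant of a kernel with `|K r| ≤ C_K (1+r)⁻⁴` is nonnegative. [folklore] -/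
theorem decay_const_nonneg {K : ℝ → ℝ} {CK : ℝ}
    (hKd : ∀ r : ℝ, 0 ≤ r → |K r| ≤ CK / (1 + r) ^ 4) : 0 ≤ CK := by
  have h := hKd 0 le_rfl
  rw [add_zero, one_pow, div_one] at h
  exact (abs_nonneg _).trans h

/-- Shell bound over a finite part of a `1/3`-separated set, subtype form: if all points of
`u ⊆ X` are at distance `≥ ρ` from `y`, then `∑_{q ∈ u} (1 + |y − q|)⁻⁴ ≤ 8788/(1+ρ)`. [folklore] -/
theorem sum_subtype_inv_pow_four_le {X : Set E3}
    (hX : ∀ p ∈ X, ∀ q ∈ X, p ≠ q → (1 / 3 : ℝ) ≤ dist p q) (y : E3) {ρ : ℝ} (hρ : 0 ≤ ρ)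
    (u : Finset ↥X) (hu : ∀ q ∈ u, ρ ≤ dist y (q : E3)) :
    ∑ q ∈ u, ((1 + dist y (q : E3)) ^ 4)⁻¹ ≤ 8788 / (1 + ρ) := by
  classical
  rw [← Finset.sum_image (f := fun z : E3 => ((1 + dist y z) ^ 4)⁻¹)
    (fun a _ b _ h => Subtype.val_injective h)]
  refine sum_inv_one_add_dist_pow_four_le _ y hρ ?_ ?_
  · intro z hz w hw hzw
    obtain ⟨a, -, rfl⟩ := Finset.mem_image.1 hz
    obtain ⟨b, -, rfl⟩ := Finset.mem_image.1 hw
    exact hX a a.2 b b.2 hzw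
  · intro z hz
    obtain ⟨a, ha, rfl⟩ := Finset.mem_image.1 hz
    exact hu a ha

/-- Kernel form of the shell bound: `∑_{q ∈ u} |K(|y − q|)| ≤ C_K · 8788/(1+ρ)` if all points of the
finite part `u` of the `1/3`-separated `X` are at distance `≥ ρ` from `y`. [folklore] -/
theorem sum_abs_kernel_le {X : Set E3}
    (hX : ∀ p ∈ X, ∀ q ∈ X, p ≠ q → (1 / 3 : ℝ) ≤ dist p q) {K : ℝ → ℝ} {CK : ℝ}
    (hKd : ∀ r : ℝ, 0 ≤ r → |K r| ≤ CK / (1 + r) ^ 4) (y : E3) {ρ : ℝ} (hρ : 0 ≤ ρ)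
    (u : Finset ↥X) (hu : ∀ q ∈ u, ρ ≤ dist y (q : E3)) :
    ∑ q ∈ u, |K ‖y - (q : E3)‖| ≤ CK * (8788 / (1 + ρ)) := by
  have hCK := decay_const_nonneg hKd
  calc ∑ q ∈ u, |K ‖y - (q : E3)‖| ≤ ∑ q ∈ u, CK * ((1 + dist y (q : E3)) ^ 4)⁻¹ := by
        refine Finset.sum_le_sum fun q _ => ?_
        rw [← div_eq_mul_inv, dist_eq_norm]
        exact hKd _ (norm_nonneg _)
    _ = CK * ∑ q ∈ u, ((1 + dist y (q : E3)) ^ 4)⁻¹ := (Finset.mul_sum _ _ _).symm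
    _ ≤ CK * (8788 / (1 + ρ)) :=
        mul_le_mul_of_nonneg_left (sum_subtype_inv_pow_four_le hX y hρ u hu) hCK

/-- **Summability.** Over a `1/3`-separated `X ⊆ ℝ³` the field `q ↦ K(|y − q|)` of a kernel with
`|K r| ≤ C_K(1+r)⁻⁴` is absolutely summable, at every `y`. [folklore] -/
theorem summable_abs_kernel {X : Set E3}
    (hX : ∀ p ∈ X, ∀ q ∈ X, p ≠ q → (1 / 3 : ℝ) ≤ dist p q) {K : ℝ → ℝ} {CK : ℝ}
    (hKd : ∀ r : ℝ, 0 ≤ r → |K r| ≤ CK / (1 + r) ^ 4) (y : E3) :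
    Summable fun q : ↥X => |K ‖y - (q : E3)‖| := by
  refine summable_of_sum_le (c := CK * (8788 / (1 + 0))) (fun q => abs_nonneg _) fun u => ?_
  exact sum_abs_kernel_le hX hKd y le_rfl u fun q _ => dist_nonneg

/-- **Summability** (signed form, the anchor of this file). [folklore] -/
theorem summable_kernel_of_separated :
    ∀ (X : Set E3) (K : ℝ → ℝ) (CK : ℝ) (y : E3),
      (∀ p ∈ X, ∀ q ∈ X, p ≠ q → (1 / 3 : ℝ) ≤ dist p q) →
      (∀ r : ℝ, 0 ≤ r → |K r| ≤ CK / (1 + r) ^ 4) →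
      Summable fun q : ↥X => K ‖y - (q : E3)‖ :=
  fun _ _ _ y hX hKd => (summable_abs_kernel hX hKd y).of_abs

/-- **Uniform bound** `|Σ_{q ∈ X} K(|y − q|)| ≤ 8788 C_K`. [folklore] -/
theorem abs_tsum_kernel_le {X : Set E3}
    (hX : ∀ p ∈ X, ∀ q ∈ X, p ≠ q → (1 / 3 : ℝ) ≤ dist p q) {K : ℝ → ℝ} {CK : ℝ}
    (hKd : ∀ r : ℝ, 0 ≤ r → |K r| ≤ CK / (1 + r) ^ 4) (y : E3) :
    |∑' q : ↥X, K ‖y - (q : E3)‖| ≤ CK * 8788 := by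
  have h1 : ‖∑' q : ↥X, K ‖y - (q : E3)‖‖ ≤ ∑' q : ↥X, ‖K ‖y - (q : E3)‖‖ :=
    norm_tsum_le_tsum_norm (summable_abs_kernel hX hKd y)
  simp only [Real.norm_eq_abs] at h1
  refine h1.trans (Real.tsum_le_of_sum_le (fun q => abs_nonneg _) fun u => ?_)
  have := sum_abs_kernel_le hX hKd y le_rfl u fun q _ => dist_nonneg
  rw [add_zero, div_one] at this
  exact this

/-- **Uniform tail bound.** If the finite part `s ⊆ X` contains every point of `X` at distance
`< ρ` from `y`, then `|Σ_{q ∈ X} K(|y − q|) − Σ_{q ∈ s} K(|y − q|)| ≤ C_K · 8788/(1+ρ)`.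
[folklore] -/
theorem abs_tsum_sub_sum_kernel_le {X : Set E3}
    (hX : ∀ p ∈ X, ∀ q ∈ X, p ≠ q → (1 / 3 : ℝ) ≤ dist p q) {K : ℝ → ℝ} {CK : ℝ}
    (hKd : ∀ r : ℝ, 0 ≤ r → |K r| ≤ CK / (1 + r) ^ 4) (y : E3) {ρ : ℝ} (hρ : 0 ≤ ρ)
    (s : Finset ↥X) (hs : ∀ q : ↥X, q ∉ s → ρ ≤ dist y (q : E3)) :
    |∑' q : ↥X, K ‖y - (q : E3)‖ - ∑ q ∈ s, K ‖y - (q : E3)‖| ≤ CK * (8788 / (1 + ρ)) := by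
  classical
  have hsum := summable_kernel_of_separated X K CK y hX hKd
  have hT : Tendsto (fun u : Finset ↥X => |∑ q ∈ u, K ‖y - (q : E3)‖ - ∑ q ∈ s, K ‖y - (q : E3)‖|)
      atTop (𝓝 |∑' q : ↥X, K ‖y - (q : E3)‖ - ∑ q ∈ s, K ‖y - (q : E3)‖|) :=
    (hsum.hasSum.sub_const _).abs
  refine le_of_tendsto hT ?_
  filter_upwards [eventually_ge_atTop s] with u hu
  rw [← Finset.sum_sdiff hu, add_sub_cancel_right]
  refine (Finset.abs_sum_le_sum_abs _ _).trans ?_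
  exact sum_abs_kernel_le hX hKd y hρ (u \ s) fun q hq => hs q (Finset.mem_sdiff.1 hq).2

/-- **Continuity of the field** `y ↦ Σ_{q ∈ X} K(|y − q|)` for a continuous kernel with
`|K r| ≤ C_K(1+r)⁻⁴` over a `1/3`-separated `X` (locally uniform convergence). [folklore] -/
theorem continuous_tsum_kernel {X : Set E3}
    (hX : ∀ p ∈ X, ∀ q ∈ X, p ≠ q → (1 / 3 : ℝ) ≤ dist p q) {K : ℝ → ℝ} {CK : ℝ}
    (hKc : Continuous K) (hKd : ∀ r : ℝ, 0 ≤ r → |K r| ≤ CK / (1 + r) ^ 4) :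
    Continuous fun y : E3 => ∑' q : ↥X, K ‖y - (q : E3)‖ := by
  have hCK := decay_const_nonneg hKd
  refine continuous_iff_continuousAt.2 fun y₀ => ?_
  have hOn : ContinuousOn (fun y : E3 => ∑' q : ↥X, K ‖y - (q : E3)‖) (closedBall y₀ 1) := by
    refine continuousOn_tsum (u := fun q : ↥X => 16 * CK * ((1 + dist y₀ (q : E3)) ^ 4)⁻¹)
      (fun q => ?_) ?_ ?_
    · exact (hKc.comp (continuous_norm.comp (continuous_id.sub continuous_const))).continuousOn
    · refine (summable_of_sum_le (c := 8788 / (1 + 0)) (fun q => by positivity)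
        fun u => ?_).mul_left (16 * CK)
      exact sum_subtype_inv_pow_four_le hX y₀ le_rfl u fun q _ => dist_nonneg
    · intro q y hy
      rw [mem_closedBall] at hy
      rw [Real.norm_eq_abs]
      refine (hKd _ (norm_nonneg _)).trans ?_
      rw [← dist_eq_norm, ← div_eq_mul_inv, div_le_div_iff₀ (by positivity) (by positivity)]
      have h1 : 1 + dist y₀ (q : E3) ≤ 2 * (1 + dist y (q : E3)) := by
        have := dist_triangle y₀ y (q : E3)
        rw [dist_comm y₀ y] at this
        linarith [dist_nonneg (x := y) (y := (q : E3))]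
      have h2 : (1 + dist y₀ (q : E3)) ^ 4 ≤ (2 * (1 + dist y (q : E3))) ^ 4 :=
        pow_le_pow_left₀ (by positivity) h1 4
      rw [mul_pow] at h2
      nlinarith [h2, hCK]
  exact hOn.continuousAt (closedBall_mem_nhds y₀ one_pos)

end Summit.AtomisticToContinuum.Crystallization.Theorems.SignedRootLocalLimit

end
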